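import Literature.NumberTheory.GaloisRepresentations.TateLocalH2Nonvanishing
import Literature.NumberTheory.GaloisRepresentations.CharacterPrescribedLocalComponentsProofs
import Literature.NumberTheory.GaloisRepresentations.DecompositionGroupOfCompletion
import Literature.NumberTheory.GaloisRepresentations.TateH2VanishingCorestriction
import Literature.NumberTheory.Automorphic.AdicCompletionLocalField
import HarnessLib

/-!
# Two-place existence for `H²(Γ_K, ℤ/ℓ)`: a class non-zero at one decomposition group and zero at another

Topic `NumberTheory/GaloisRepresentations`; namespace
`Literature.NumberTheory.GaloisRepresentations.ExplicitMuCocycles`.  Proof file: theorems only (no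
definition, no instance, no named fact).

Let `K` be a number field containing a primitive `ℓ`-th root of unity (`ℓ` prime) and `v₁ ≠ v₂`
finite places.  There is a locally constant `ℤ/ℓ`-valued `2`-cocycle `z` on `Γ_K` which is NOT an
explicit coboundary on the decomposition group `D_{𝔓₀(v₁)}` but IS one on `D_{𝔓₀(v₂)}`
(`exists_cocycle_not_coboundaryOn_and_coboundaryOn`).  Construction (Serre, Durham §6.5 (b) made
global by Clozel–Harris–Taylor Lemma 4.1.1): at `K_{v₁}` the lift `t` of `θ(ζ_ℓ)` (local reciprocity)
is killed by no locally constant character of `ℓ`-divisible type, giving a local character `χ₁` with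
`χ₁(t) ≠ 0` (`exists_character_not_nsmul`); a global finite-order character `ψ` with `ψ|_{v₁} = χ₁`,
`ψ|_{v₂} = 0` exists (`ClozelHarrisTaylor2008.exists_character_restrict_eq_holds`); `z = ∂(ψ/ℓ)` read in
`ℤ/ℓ ≅ (ℚ/ℤ)[ℓ]`.  It is the instance, at the full group of a number field, of the hypothesis (AxG)
"two-place existence" of the abstract Neukirch lemma (`NeukirchAbstractContainment.lean`; abc-iut
GAP-LEDGER G-L4d2g4-1, campaign L); classical; nothing here bears on [IUTchIII] Cor. 3.12.

## References

* J.-P. Serre, *Modular forms of weight one and Galois representations* (Durham 1977), §6.5 (b).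
  [SerreDurham1977]
* L. Clozel, M. Harris, R. Taylor, Publ. Math. IHÉS 108 (2008), Lemma 4.1.1. [ClozelHarrisTaylor2008]
* J. Neukirch, A. Schmidt, K. Wingberg, *Cohomology of Number Fields* (2008), (9.2.8), (12.1.9).
  [NeukirchSchmidtWingberg2008]
-/

noncomputable section

open Function Field IsDedekindDomain NumberField

namespace Literature.NumberTheory.GaloisRepresentations.ExplicitMuCocycles

open Literature.NumberTheory.GaloisRepresentations

/-! ### Local: a character of `Γ_F` which is not `ℓ`-divisible -/

/-- **A non-`ℓ`-divisible character of a local Galois group** (Serre §6.5 (b)): for a non-archimedean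
local field `F` of characteristic `0` containing a primitive `ℓ`-th root of unity there is a locally
constant character `χ : Γ_F → ℚ/ℤ` such that `ℓ γ ≠ χ` for every locally constant character `γ`
(take `χ` non-trivial on a lift `t` of `θ(ζ_ℓ)`; every character kills `t^ℓ`).
[cite: SerreDurham1977, §6.5 (b)] -/
theorem exists_character_not_nsmul (F : Type) [Field F] [ValuativeRel F] [TopologicalSpace F]
    [IsNonarchimedeanLocalField F] [CharZero F] {ℓ : ℕ} (hℓ : ℓ.Prime) {ζ : F} (hζ : IsPrimitiveRoot ζ ℓ) :
    ∃ χ : absoluteGaloisGroup F → AddCircle (1 : ℚ), IsLocallyConstant χ ∧ (∀ σ τ, χ (σ * τ) = χ σ + χ τ) ∧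
      ∀ γ : absoluteGaloisGroup F → AddCircle (1 : ℚ), IsLocallyConstant γ →
        (∀ σ τ, γ (σ * τ) = γ σ + γ τ) → ¬ ∀ σ, ℓ • γ σ = χ σ := by
  obtain ⟨θ, hθ⟩ := exists_isLocalReciprocityMap_holds F
  have hζu : IsUnit ζ := hζ.isUnit hℓ.ne_zero
  obtain ⟨t, ht⟩ := QuotientGroup.mk_surjective (θ hζu.unit)
  have htC : t ∉ (commutator (absoluteGaloisGroup F)).topologicalClosure := by
    intro htC
    have h1 : (QuotientGroup.mk t : absoluteGaloisGroupAbelianization F) = 1 :=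
      (QuotientGroup.eq_one_iff t).2 htC
    rw [ht] at h1
    have hu : hζu.unit = 1 := hθ.injective (by rw [h1, map_one])
    have hζ1 : ζ = 1 := by rw [← hζu.unit_spec, hu, Units.val_one]
    exact hζ.ne_one hℓ.one_lt hζ1
  have htpC : t ^ ℓ ∈ (commutator (absoluteGaloisGroup F)).topologicalClosure := by
    refine (QuotientGroup.eq_one_iff (t ^ ℓ)).1 ?_
    have hup : hζu.unit ^ ℓ = 1 := Units.ext (by
      rw [Units.val_pow_eq_pow_val, hζu.unit_spec, hζ.pow_eq_one, Units.val_one])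
    rw [QuotientGroup.mk_pow, ht, ← map_pow, hup, map_one]
  obtain ⟨χ, hχ_lc, hχmul, hχt⟩ := exists_isLocallyConstant_character_apply_ne_zero htC
  refine ⟨χ, hχ_lc, hχmul, fun γ hγ_lc hγmul hγ => hχt ?_⟩
  have h0 := character_apply_eq_zero_of_mem_closure_commutator hγ_lc hγmul htpC
  rw [character_apply_pow hγmul, hγ] at h0
  exact h0

/-! ### Global: the two-place class -/

/-- **Two-place existence** ([NSW] (12.1.9) input; Clozel–Harris–Taylor Lemma 4.1.1 + Serre §6.5 (b)).
`K` a number field with a primitive `ℓ`-th root of unity, `v₁ ≠ v₂` finite places: there is a locally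
constant `ℤ/ℓ`-valued `2`-cocycle on `Γ_K` which is not an explicit coboundary on `D_{𝔓₀(v₁)}` and is
one on `D_{𝔓₀(v₂)}`. [cite: NeukirchSchmidtWingberg2008, Prop (12.1.9)]
[cite: ClozelHarrisTaylor2008, Lemma 4.1.1 (p. 116)] -/
theorem exists_cocycle_not_coboundaryOn_and_coboundaryOn (K : Type) [Field K] [NumberField K]
    {ℓ : ℕ} (hℓ : ℓ.Prime) {ζ : K} (hζ : IsPrimitiveRoot ζ ℓ) {v₁ v₂ : HeightOneSpectrum (𝓞 K)}
    (hv : v₁ ≠ v₂) :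
    ∃ z : absoluteGaloisGroup K → absoluteGaloisGroup K → ZMod ℓ,
      IsLocallyConstant (uncurry z) ∧ (∀ σ τ υ, z σ τ + z (σ * τ) υ = z τ υ + z σ (τ * υ)) ∧
      (¬ ∃ β : absoluteGaloisGroup K → ZMod ℓ,
        IsLocallyConstant
          (fun s : ↥((adicCompletionPrime K v₁).decompositionSubgroup (absoluteGaloisGroup K)) => β s) ∧
        ∀ a ∈ (adicCompletionPrime K v₁).decompositionSubgroup (absoluteGaloisGroup K),
          ∀ b ∈ (adicCompletionPrime K v₁).decompositionSubgroup (absoluteGaloisGroup K),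
            z a b = β a + β b - β (a * b)) ∧
      ∃ β : absoluteGaloisGroup K → ZMod ℓ,
        IsLocallyConstant
          (fun s : ↥((adicCompletionPrime K v₂).decompositionSubgroup (absoluteGaloisGroup K)) => β s) ∧
        ∀ a ∈ (adicCompletionPrime K v₂).decompositionSubgroup (absoluteGaloisGroup K),
          ∀ b ∈ (adicCompletionPrime K v₂).decompositionSubgroup (absoluteGaloisGroup K),
            z a b = β a + β b - β (a * b) := by
  classical
  haveI : Fact ℓ.Prime := ⟨hℓ⟩
  haveI : NeZero ℓ := ⟨hℓ.ne_zero⟩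
  haveI : CharZero (v₁.adicCompletion K) :=
    charZero_of_injective_algebraMap (algebraMap K (v₁.adicCompletion K)).injective
  -- the local character at `v₁`
  have hζ₁ : IsPrimitiveRoot (algebraMap K (v₁.adicCompletion K) ζ) ℓ :=
    hζ.map_of_injective (algebraMap K (v₁.adicCompletion K)).injective
  obtain ⟨χ₁, hχ₁_lc, hχ₁mul, hχ₁⟩ := exists_character_not_nsmul (v₁.adicCompletion K) hℓ hζ₁
  -- the global character: `χ₁` at `v₁`, `0` at `v₂`
  let χ : ∀ v : HeightOneSpectrum (𝓞 K), absoluteGaloisGroup (v.adicCompletion K) → AddCircle (1 : ℚ) :=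
    fun v => if h : v = v₁ then (fun σ => χ₁ (cast (by rw [h]) σ)) else fun _ => 0
  have hχv₁ : χ v₁ = χ₁ := by
    funext σ
    simp [χ]
  have hχv₂ : χ v₂ = fun _ => 0 := by
    funext σ
    simp [χ, Ne.symm hv]
  obtain ⟨ψ, hψ_lc, hψmul, hψ⟩ := ClozelHarrisTaylor2008.exists_character_restrict_eq_holds K {v₁, v₂} χ
    (fun v hv' => by
      rcases Finset.mem_insert.1 hv' with rfl | hv'
      · rw [hχv₁]; exact ⟨hχ₁_lc, hχ₁mul⟩
      · rw [Finset.mem_singleton] at hv'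
        subst hv'
        rw [hχv₂]; exact ⟨IsLocallyConstant.const _, fun _ _ => by simp⟩)
  have hψ₁ : ∀ σ, ψ (absGaloisRestrict K (v₁.adicCompletion K) σ) = χ₁ σ := fun σ => by
    rw [hψ v₁ (by simp), hχv₁]
  have hψ₂ : ∀ σ, ψ (absGaloisRestrict K (v₂.adicCompletion K) σ) = 0 := fun σ => by
    rw [hψ v₂ (by simp), hχv₂]
  -- `z = ∂(ψ/ℓ)` read in `ℤ/ℓ`
  obtain ⟨h, hh⟩ := addCircle_exists_fun_nsmul_eq hℓ.pos
  set c : absoluteGaloisGroup K → AddCircle (1 : ℚ) := h ∘ ψ with hcdef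
  have hc_lc : IsLocallyConstant c := hψ_lc.comp h
  set d : absoluteGaloisGroup K → absoluteGaloisGroup K → AddCircle (1 : ℚ) :=
    fun σ τ => c σ + c τ - c (σ * τ) with hddef
  have hdℓ : ∀ σ τ, ℓ • d σ τ = 0 := fun σ τ => by
    simp only [hddef, hcdef, Function.comp, nsmul_sub, nsmul_add, hh, hψmul, sub_self]
  obtain ⟨e', he', -, he'surj⟩ := zmod_exists_addMonoidHom_addCircle hℓ.pos
  have hchoice : ∀ x : AddCircle (1 : ℚ), ∃ k : ZMod ℓ, ℓ • x = 0 → e' k = x := fun x => by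
    by_cases hx : ℓ • x = 0
    · obtain ⟨k, hk⟩ := he'surj x hx
      exact ⟨k, fun _ => hk⟩
    · exact ⟨0, fun h' => absurd h' hx⟩
  choose κ hκ using hchoice
  set z : absoluteGaloisGroup K → absoluteGaloisGroup K → ZMod ℓ := fun σ τ => κ (d σ τ) with hzdef
  have hz : ∀ σ τ, e' (z σ τ) = d σ τ := fun σ τ => hκ _ (hdℓ σ τ)
  refine ⟨z, ?_, ?_, ?_, ?_⟩
  · -- locally constant
    have hd_lc : IsLocallyConstant (uncurry d) := isLocallyConstant_coboundary hc_lc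
    exact hd_lc.comp κ
  · -- cocycle
    intro σ τ υ
    apply he'
    rw [map_add, map_add, hz, hz, hz, hz]
    exact coboundary_isTwoCocycle c σ τ υ
  · -- not a coboundary on `D_{𝔓₀(v₁)}`
    rintro ⟨β, hβ_lc, hβ⟩
    set D := (adicCompletionPrime K v₁).decompositionSubgroup (absoluteGaloisGroup K) with hDdef
    set r := absGaloisRestrict K (v₁.adicCompletion K) with hr
    have hrD : ∀ x, r x ∈ D := fun x => by
      rw [hDdef, decompositionSubgroup_adicCompletionPrime_eq_range]
      exact ⟨x, rfl⟩
    -- `γ = ψ/ℓ ∘ r - e' ∘ β ∘ r` is a character with `ℓ γ = χ₁`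
    set γ : absoluteGaloisGroup (v₁.adicCompletion K) → AddCircle (1 : ℚ) :=
      fun x => c (r x) - e' (β (r x)) with hγdef
    have hβr_lc : IsLocallyConstant (fun x : absoluteGaloisGroup (v₁.adicCompletion K) => β (r x)) :=
      hβ_lc.comp_continuous (f := fun x => (⟨r x, hrD x⟩ : D)) (Continuous.subtype_mk r.continuous _)
    have hγ_lc : IsLocallyConstant γ :=
      (hc_lc.comp_continuous r.continuous).comp₂ (hβr_lc.comp e') (· - ·)
    have hγmul : ∀ x y, γ (x * y) = γ x + γ y := fun x y => by
      have h1 := hβ (r x) (hrD x) (r y) (hrD y)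
      have h2 : d (r x) (r y) = e' (β (r x)) + e' (β (r y)) - e' (β (r x * r y)) := by
        rw [← hz, h1, map_sub, map_add]
      simp only [hγdef, map_mul]
      simp only [hddef] at h2
      have h3 : c (r x * r y) =
          c (r x) + c (r y) - (e' (β (r x)) + e' (β (r y)) - e' (β (r x * r y))) := by
        rw [← h2]; abel
      rw [h3]; abel
    refine hχ₁ γ hγ_lc hγmul fun x => ?_
    simp only [hγdef, nsmul_sub, hcdef, Function.comp, hh, hψ₁]
    rw [← map_nsmul, nsmul_eq_mul, ZMod.natCast_self, zero_mul, map_zero, sub_zero]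
  · -- a coboundary on `D_{𝔓₀(v₂)}` (constant cochain)
    set D := (adicCompletionPrime K v₂).decompositionSubgroup (absoluteGaloisGroup K) with hDdef
    have hψD : ∀ a ∈ D, ψ a = 0 := fun a ha => by
      rw [hDdef, decompositionSubgroup_adicCompletionPrime_eq_range] at ha
      obtain ⟨x, rfl⟩ := ha
      exact hψ₂ x
    refine ⟨fun _ => κ (h 0), IsLocallyConstant.const _, fun a ha b hb => ?_⟩
    apply he'
    have h0ℓ : ℓ • h 0 = 0 := hh 0
    rw [hz, map_sub, map_add, hκ _ h0ℓ]
    simp only [hddef, hcdef, Function.comp, hψD a ha, hψD b hb, hψD _ (D.mul_mem ha hb)]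

end Literature.NumberTheory.GaloisRepresentations.ExplicitMuCocycles

end
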